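import Mathlib
import Literature.MathematicalPhysics.MHD.SolovevFluxSurfaceMercier
import HarnessLib

/-!
# `dV/dψ` (6.22) and the toroidal current `∮B_p dl` (6.27) of the Lee–Cerfon Solov'ev equilibrium on the
# printed flux-surface loop as explicit one-dimensional integrals (proved)

Fourth file of the `lcLoop` series. For `Ψ = psiLC κ F_B R₀ q₀ a` [Lee–Cerfon 2015 §4.1 (solo2), bib
`LeeCerfon2015`] on the PRINTED loop `lcLoop R₀ κ r` (`u = R₀² + 2rR₀cos t`, `c = κF_B/(2R₀³q₀)`), using
`speed_lcLoop` (`|γ′| = (κ/(2cu))|∇Ψ|`) and `fieldBpol_lcLoop` (`B_p = |∇Ψ|/√u`) of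
`SolovevFluxSurfaceMercier.lean`:

* **`volumeDerivE_lcLoop`** — Freidberg's `dV/dψ = 2π∮ dl/B_p` (2014, eq. (6.22); `GradShafranov.volumeDerivE`,
  Euclidean arc length) equals `2π ∫₀^{2π} κ/(2c√u) dt` — the `|∇Ψ|` cancels: `dl/B_p = (κ√u/(2cu)) dt`;
* **`toroidalCurrentE_lcLoop`** — `I = (1/μ₀)∮ B_p dl` (eq. (6.27); `GradShafranov.toroidalCurrentE`) equals
  `(1/μ₀)∫₀^{2π} κ·|∇Ψ|²/(2cu√u) dt` with `|∇Ψ|² = lcGradSq` explicit.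

These are the flux-surface inputs `V′(ψ)`, `I(ψ)` of the intrinsic (Glasser–Greene–Johnson / Jardin (8.134))
form of Mercier's criterion, per surface, as certified-quadrature targets. HONEST FRAMING: exact real analysis
about MODEL objects; enclosures are a Bench matter; nothing here says anything is stable.
Typer/prover: gridfusion-model-5 (g2), 2026-08-27.
-/

noncomputable section

namespace Literature.MathematicalPhysics.MHD.Solovev

open GradShafranov FluxGeometry _root_.Real MeasureTheory intervalIntegral

/-- Pointwise: `(1/B_p)·|γ′| = κ/(2c√u)` along the loop. [cite: Freidberg2014, §6.3.2 eq. (6.22)] -/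
theorem lcLoop_volumeIntegrand {R₀ κ FB q₀ r : ℝ} (hR₀ : 0 < R₀) (hκ : 0 < κ) (hFB : 0 < FB)
    (hq₀ : 0 < q₀) (hr : 0 < r) (h2r : 2 * r < R₀) (a t : ℝ) :
    1 / fieldBpol (psiLC κ FB R₀ q₀ a) (lcLoop R₀ κ r t).1 (lcLoop R₀ κ r t).2 * speed (lcLoop R₀ κ r) t
      = κ / (2 * (κ * FB / (2 * R₀ ^ 3 * q₀)) * Real.sqrt (lcU R₀ r t)) := by
  have hu := lcU_pos hR₀ hr.le h2r t
  have hN : 0 < Real.sqrt (gradSq (psiLC κ FB R₀ q₀ a) (lcLoop R₀ κ r t).1 (lcLoop R₀ κ r t).2) := by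
    rw [gradSq_psiLC_lcLoop hR₀ hκ.ne' hr.le h2r]
    exact Real.sqrt_pos.2 (lcGradSq_pos hR₀ hκ hFB hq₀ hr h2r t)
  have hc : 0 < κ * FB / (2 * R₀ ^ 3 * q₀) := by positivity
  rw [speed_lcLoop hR₀ hκ hFB hq₀ hr.le h2r a t, fieldBpol_lcLoop hR₀ hr.le h2r]
  set M := Real.sqrt (gradSq (psiLC κ FB R₀ q₀ a) (lcLoop R₀ κ r t).1 (lcLoop R₀ κ r t).2) with hM
  set s := Real.sqrt (lcU R₀ r t) with hs_def
  have hs : 0 < s := Real.sqrt_pos.2 hu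
  have hu' : lcU R₀ r t = s ^ 2 := by rw [hs_def, Real.sq_sqrt hu.le]
  rw [hu']
  field_simp

/-- **`dV/dψ` (6.22) on the printed loop:** `volumeDerivE Ψ (lcLoop R₀ κ r) (2π) = 2π∫₀^{2π} κ/(2c√u) dt`
(every surface `0 < r < R₀/2`; `κ, F_B, q₀ > 0`). [cite: Freidberg2014, §6.3.2 eq. (6.22)] -/
theorem volumeDerivE_lcLoop {R₀ κ FB q₀ r : ℝ} (hR₀ : 0 < R₀) (hκ : 0 < κ) (hFB : 0 < FB) (hq₀ : 0 < q₀)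
    (hr : 0 < r) (h2r : 2 * r < R₀) (a : ℝ) :
    volumeDerivE (psiLC κ FB R₀ q₀ a) (lcLoop R₀ κ r) (2 * π)
      = 2 * π * ∫ t in (0 : ℝ)..(2 * π), κ / (2 * (κ * FB / (2 * R₀ ^ 3 * q₀)) * Real.sqrt (lcU R₀ r t)) := by
  unfold volumeDerivE loopIntegralE
  congr 1
  exact intervalIntegral.integral_congr fun t _ => lcLoop_volumeIntegrand hR₀ hκ hFB hq₀ hr h2r a t

/-- Pointwise: `B_p·|γ′| = κ|∇Ψ|²/(2cu√u)` along the loop. [cite: Freidberg2014, §6.3.3 eq. (6.27)] -/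
theorem lcLoop_currentIntegrand {R₀ κ FB q₀ r : ℝ} (hR₀ : 0 < R₀) (hκ : 0 < κ) (hFB : 0 < FB)
    (hq₀ : 0 < q₀) (hr : 0 < r) (h2r : 2 * r < R₀) (a t : ℝ) :
    fieldBpol (psiLC κ FB R₀ q₀ a) (lcLoop R₀ κ r t).1 (lcLoop R₀ κ r t).2 * speed (lcLoop R₀ κ r) t
      = κ * lcGradSq κ FB R₀ q₀ r t
          / (2 * (κ * FB / (2 * R₀ ^ 3 * q₀)) * lcU R₀ r t * Real.sqrt (lcU R₀ r t)) := by
  have hu := lcU_pos hR₀ hr.le h2r t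
  have hG := lcGradSq_pos hR₀ hκ hFB hq₀ hr h2r t
  have hc : 0 < κ * FB / (2 * R₀ ^ 3 * q₀) := by positivity
  rw [speed_lcLoop hR₀ hκ hFB hq₀ hr.le h2r a t, fieldBpol_lcLoop hR₀ hr.le h2r,
    gradSq_psiLC_lcLoop hR₀ hκ.ne' hr.le h2r]
  set M := Real.sqrt (lcGradSq κ FB R₀ q₀ r t) with hM
  have hM0 : 0 < M := Real.sqrt_pos.2 hG
  have hM2 : lcGradSq κ FB R₀ q₀ r t = M ^ 2 := by rw [hM, Real.sq_sqrt hG.le]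
  set s := Real.sqrt (lcU R₀ r t) with hs_def
  have hs : 0 < s := Real.sqrt_pos.2 hu
  have hu' : lcU R₀ r t = s ^ 2 := by rw [hs_def, Real.sq_sqrt hu.le]
  rw [hM2, hu']
  field_simp

/-- **Toroidal current (6.27) on the printed loop:** `toroidalCurrentE μ₀ Ψ (lcLoop R₀ κ r) (2π)
= (∫₀^{2π} κ·lcGradSq/(2cu√u) dt)/μ₀`. [cite: Freidberg2014, §6.3.3 eq. (6.27)] -/
theorem toroidalCurrentE_lcLoop {R₀ κ FB q₀ r : ℝ} (hR₀ : 0 < R₀) (hκ : 0 < κ) (hFB : 0 < FB)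
    (hq₀ : 0 < q₀) (hr : 0 < r) (h2r : 2 * r < R₀) (μ0 a : ℝ) :
    toroidalCurrentE μ0 (psiLC κ FB R₀ q₀ a) (lcLoop R₀ κ r) (2 * π)
      = (∫ t in (0 : ℝ)..(2 * π), κ * lcGradSq κ FB R₀ q₀ r t
          / (2 * (κ * FB / (2 * R₀ ^ 3 * q₀)) * lcU R₀ r t * Real.sqrt (lcU R₀ r t))) / μ0 := by
  unfold toroidalCurrentE loopIntegralE
  congr 1
  exact intervalIntegral.integral_congr fun t _ => lcLoop_currentIntegrand hR₀ hκ hFB hq₀ hr h2r a t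

end Literature.MathematicalPhysics.MHD.Solovev
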